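import Summits.Ventures.PercRepro.S1NineSixRankSevenElevenProfile

/-!
# PercRepro — THE PLANE BOUND: RANK-3 FOUR-SETS AGAINST RANK-3 TRIPLES (p2, gen 28; SUBCLAIM-S1 §6.10 (xvii)(q))

With all pairs of rank `2` and every rank-`3` triple spanning a flat of at most `6` points: a rank-`3` four-set
contains at least three rank-`3` triples (two rank-`2` triples of a four-set share a pair, so both lie in one
closure of rank `2` and so does their union), and a rank-`3` triple `T` extends to at most `|cl T| − 3 ≤ 3`
rank-`3` four-sets; hence `3 · #rkSets 4 3 ≤ 3 · #rkSets 3 3`. Nothing is claimed about any cell.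

* `tripleFourPairs`; **`ncard_rkSets_four_three_le`**.
Axioms: standard.
-/

open scoped Matroid

namespace PercRepro

namespace S1

open Set

variable {α : Type}

/-- The incidences «a rank-`3` triple inside a rank-`3` four-set». -/
def tripleFourPairs (M : Matroid α) : Set (Set α × Set α) :=
  {R : Set α × Set α | R.1 ∈ rkSets M 4 3 ∧ R.2 ⊆ R.1 ∧ R.2 ∈ rkSets M 3 3}

variable {M : Matroid α} [M.Finite]

/-- Two distinct triples of a four-set share a pair, so at most one of them has rank `2` when the four-set has
rank `3`. -/
theorem rankTwo_triples_of_rkSets_four_three_le_one (hpairs : ∀ e ∈ M.E, ∀ f ∈ M.E, e ≠ f → M.eRk {e, f} = 2)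
    {Q : Set α} (hQ : Q ∈ rkSets M 4 3) : {T : Set α | T ⊆ Q ∧ T.ncard = 3 ∧ M.eRk T = 2}.ncard ≤ 1 := by
  obtain ⟨hQE, hQ4, hQ3⟩ := hQ
  have hQfin : Q.Finite := M.ground_finite.subset hQE
  by_contra hlt
  push Not at hlt
  obtain ⟨T, hT, T', hT', hTT⟩ := (Set.one_lt_ncard (hQfin.finite_subsets.subset (fun _ h => h.1))).mp hlt
  -- `T ∩ T'` has `2` points
  have hTfin : T.Finite := hQfin.subset hT.1
  have hT'fin : T'.Finite := hQfin.subset hT'.1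
  have hunion : T ∪ T' ⊆ Q := union_subset hT.1 hT'.1
  have hu := ncard_union_add_ncard_inter T T' hTfin hT'fin
  have hu4 : (T ∪ T').ncard ≤ 4 := by
    have := ncard_le_ncard hunion hQfin; rwa [hQ4] at this
  have hi : 2 ≤ (T ∩ T').ncard := by rw [hT.2.1, hT'.2.1] at hu; omega
  obtain ⟨x, hx, y, hy, hxy⟩ := (Set.one_lt_ncard (hTfin.inter_of_left _)).mp (by omega : 1 < (T ∩ T').ncard)
  -- both triples lie in `cl {x, y}`, hence so does `Q = T ∪ T'` (`|T ∪ T'| = 4`)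
  have hTcl := subset_closure_pair_of_eRk_two hpairs (hT.1.trans hQE) hT.2.2 hx.1 hy.1 hxy
  have hT'cl := subset_closure_pair_of_eRk_two hpairs (hT'.1.trans hQE) hT'.2.2 hx.2 hy.2 hxy
  have hQeq : Q = T ∪ T' := by
    refine (eq_of_subset_of_ncard_le hunion ?_ hQfin).symm
    rw [hQ4]
    have hne : T ≠ T' := hTT
    have hi2 : (T ∩ T').ncard ≤ 2 := by
      by_contra h3
      push Not at h3
      have : T ∩ T' = T := eq_of_subset_of_ncard_le inter_subset_left (by rw [hT.2.1]; omega) hTfin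
      have : T ⊆ T' := by rw [← this]; exact inter_subset_right
      exact hne (eq_of_subset_of_ncard_le this (by rw [hT.2.1, hT'.2.1]) hT'fin)
    rw [hT.2.1, hT'.2.1] at hu
    omega
  have hQcl : Q ⊆ M.closure {x, y} := by rw [hQeq]; exact union_subset hTcl hT'cl
  have h2 : M.eRk Q ≤ 2 := by
    have := M.eRk_mono hQcl
    rw [M.eRk_closure_eq, hpairs x (hQE (hT.1 hx.1)) y (hQE (hT.1 hy.1)) hxy] at this
    exact this
  rw [hQ3] at h2
  exact absurd h2 (by decide)

/-- A rank-`3` four-set has at least `3` rank-`3` triples. -/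
theorem three_le_ncard_rank_three_triples (hpairs : ∀ e ∈ M.E, ∀ f ∈ M.E, e ≠ f → M.eRk {e, f} = 2)
    {Q : Set α} (hQ : Q ∈ rkSets M 4 3) : 3 ≤ {T : Set α | T ⊆ Q ∧ T ∈ rkSets M 3 3}.ncard := by
  have hQfin : Q.Finite := M.ground_finite.subset hQ.1
  have hall : {T : Set α | T ⊆ Q ∧ T.ncard = 3}.ncard = 4 := by
    rw [ncard_setOf_subset_ncard_eq hQfin 3, hQ.2.1]; decide
  have hsub : {T : Set α | T ⊆ Q ∧ T.ncard = 3} ⊆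
      {T : Set α | T ⊆ Q ∧ T ∈ rkSets M 3 3} ∪ {T : Set α | T ⊆ Q ∧ T.ncard = 3 ∧ M.eRk T = 2} := by
    rintro T ⟨hTQ, hT3⟩
    have hTE : T ⊆ M.E := hTQ.trans hQ.1
    have hle : M.eRk T ≤ M.eRk Q := M.eRk_mono hTQ
    rw [hQ.2.2] at hle
    obtain ⟨n, hn⟩ := ENat.ne_top_iff_exists.mp (ne_top_of_le_ne_top (by decide) hle)
    have hlo := two_le_eRk_of_two_le_ncard hpairs hTE (by omega)
    rw [← hn] at hle hlo
    have hn3 : n ≤ 3 := by exact_mod_cast hle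
    have hn2 : 2 ≤ n := by exact_mod_cast hlo
    rcases Nat.lt_or_ge n 3 with h | h
    · right; refine ⟨hTQ, hT3, ?_⟩; rw [← hn]; have : n = 2 := by omega
      rw [this]; rfl
    · left; refine ⟨hTQ, hTE, hT3, ?_⟩; rw [← hn]; have : n = 3 := by omega
      rw [this]
  have h := ncard_le_ncard hsub ((hQfin.finite_subsets.subset (fun _ h => h.1)).union
    (hQfin.finite_subsets.subset (fun _ h => h.1)))
  rw [hall] at h
  have h1 := rankTwo_triples_of_rkSets_four_three_le_one hpairs hQ
  have := ncard_union_le {T : Set α | T ⊆ Q ∧ T ∈ rkSets M 3 3} {T : Set α | T ⊆ Q ∧ T.ncard = 3 ∧ M.eRk T = 2}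
  omega

/-- The incidences are finite. -/
theorem tripleFourPairs_finite : (tripleFourPairs M).Finite :=
  (M.ground_finite.finite_subsets.prod M.ground_finite.finite_subsets).subset
    (fun _ hR => ⟨hR.1.1, hR.2.2.1⟩)

/-- **THE PLANE BOUND**: with all pairs of rank `2` and every rank-`3` triple spanning at most `6` points,
`#rkSets 4 3 ≤ #rkSets 3 3`. -/
theorem ncard_rkSets_four_three_le (hpairs : ∀ e ∈ M.E, ∀ f ∈ M.E, e ≠ f → M.eRk {e, f} = 2)
    (hcl3 : ∀ T ∈ rkSets M 3 3, (M.closure T).ncard ≤ 6) : (rkSets M 4 3).ncard ≤ (rkSets M 3 3).ncard := by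
  have hQfin := rkSets_finite (M := M) 4 3
  have hTfin := rkSets_finite (M := M) 3 3
  have hIfin := tripleFourPairs_finite (M := M)
  -- lower side: `≥ 3` triples per four-set
  have heq : tripleFourPairs M = ⋃ Q ∈ rkSets M 4 3,
      ({Q} ×ˢ {T : Set α | T ⊆ Q ∧ T ∈ rkSets M 3 3} : Set (Set α × Set α)) := by
    ext ⟨Q, T⟩
    simp only [tripleFourPairs, mem_setOf_eq, mem_iUnion, mem_prod, mem_singleton_iff, exists_prop]
    constructor
    · rintro ⟨hQ, hTQ, hT⟩
      exact ⟨Q, hQ, rfl, hTQ, hT⟩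
    · rintro ⟨Q', hQ', rfl, hTQ, hT⟩
      exact ⟨hQ', hTQ, hT⟩
  have hfib : ∀ Q ∈ rkSets M 4 3,
      (({Q} ×ˢ {T : Set α | T ⊆ Q ∧ T ∈ rkSets M 3 3} : Set (Set α × Set α))).Finite :=
    fun Q hQ => (finite_singleton Q).prod ((M.ground_finite.subset hQ.1).finite_subsets.subset (fun _ h => h.1))
  have hdisj : (rkSets M 4 3).PairwiseDisjoint
      (fun Q : Set α => ({Q} ×ˢ {T : Set α | T ⊆ Q ∧ T ∈ rkSets M 3 3} : Set (Set α × Set α))) := by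
    intro Q _ Q' _ hQQ
    rw [Function.onFun, Set.disjoint_left]
    rintro ⟨C, T⟩ ⟨hC1, -⟩ ⟨hC2, -⟩
    apply hQQ
    rw [mem_singleton_iff] at hC1 hC2
    rw [← hC1, ← hC2]
  have hlow : 3 * (rkSets M 4 3).ncard ≤ (tripleFourPairs M).ncard := by
    rw [heq, hQfin.ncard_biUnion hfib hdisj, finsum_mem_eq_finite_toFinset_sum _ hQfin]
    calc 3 * (rkSets M 4 3).ncard = hQfin.toFinset.card • 3 := by
          rw [smul_eq_mul, ← ncard_eq_toFinset_card _ hQfin, mul_comm]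
      _ ≤ ∑ Q ∈ hQfin.toFinset, (({Q} ×ˢ {T : Set α | T ⊆ Q ∧ T ∈ rkSets M 3 3} : Set (Set α × Set α))).ncard := by
          apply Finset.card_nsmul_le_sum
          intro Q hQ
          rw [Finite.mem_toFinset] at hQ
          rw [ncard_prod, ncard_singleton, one_mul]
          exact three_le_ncard_rank_three_triples hpairs hQ
  -- upper side: `≤ 3` four-sets per triple
  have hup : tripleFourPairs M ⊆ ⋃ T ∈ rkSets M 3 3, {R ∈ tripleFourPairs M | R.2 = T} := by
    rintro ⟨Q, T⟩ ⟨hQ, hTQ, hT⟩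
    rw [mem_iUnion₂]
    exact ⟨T, hT, ⟨hQ, hTQ, hT⟩, rfl⟩
  have hfibT : ∀ T ∈ rkSets M 3 3, {R ∈ tripleFourPairs M | R.2 = T}.ncard ≤ 3 := by
    intro T hT
    have hTE : T ⊆ M.E := hT.1
    have hTfin' : T.Finite := M.ground_finite.subset hTE
    have hclfin : (M.closure T).Finite := M.ground_finite.subset (M.closure_subset_ground _)
    have hsub : {R ∈ tripleFourPairs M | R.2 = T} ⊆ (fun x => (insert x T, T)) '' (M.closure T \ T) := by
      rintro ⟨Q, T'⟩ ⟨⟨hQ, hTQ, -⟩, hTT⟩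
      have hTT' : T = T' := (hTT : T' = T).symm
      subst hTT'
      have h1 : (Q \ T).ncard = 1 := by rw [ncard_sdiff' hTQ (M.ground_finite.subset hQ.1), hQ.2.1, hT.2.1]
      obtain ⟨x, hx⟩ := ncard_eq_one.mp h1
      have hxmem : x ∈ Q \ T := by rw [hx]; exact mem_singleton x
      have hQeq : Q = insert x T := by
        ext w
        constructor
        · intro hw
          by_cases hwT : w ∈ T
          · exact Or.inr hwT
          · have : w ∈ Q \ T := ⟨hw, hwT⟩
            rw [hx] at this
            exact Or.inl this
        · rintro (rfl | hw)
          · exact hxmem.1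
          · exact hTQ hw
      refine ⟨x, ⟨?_, hxmem.2⟩, by simp only [Prod.mk.injEq, and_true]; exact hQeq.symm⟩
      rw [mem_closure_iff_eRk_insert_eq M (hQ.1 hxmem.1) hTE, ← hQeq, hQ.2.2, hT.2.2]
    have hfin' : (M.closure T \ T).Finite := hclfin.subset sdiff_subset
    refine (ncard_le_ncard hsub (hfin'.image _)).trans ((ncard_image_le hfin').trans ?_)
    rw [ncard_sdiff' (M.subset_closure T hTE) hclfin, hT.2.1]
    have := hcl3 T hT
    omega
  have hupper : (tripleFourPairs M).ncard ≤ 3 * (rkSets M 3 3).ncard := by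
    calc (tripleFourPairs M).ncard ≤ (⋃ T ∈ rkSets M 3 3, {R ∈ tripleFourPairs M | R.2 = T}).ncard :=
          ncard_le_ncard hup (hTfin.biUnion (fun T _ => hIfin.subset (fun R hR => hR.1)))
      _ ≤ ∑ᶠ T ∈ rkSets M 3 3, {R ∈ tripleFourPairs M | R.2 = T}.ncard := hTfin.ncard_biUnion_le _
      _ = ∑ T ∈ hTfin.toFinset, {R ∈ tripleFourPairs M | R.2 = T}.ncard := finsum_mem_eq_finite_toFinset_sum _ hTfin
      _ ≤ hTfin.toFinset.card • 3 := by
          apply Finset.sum_le_card_nsmul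
          intro T hT
          rw [Finite.mem_toFinset] at hT
          exact hfibT T hT
      _ = 3 * (rkSets M 3 3).ncard := by rw [smul_eq_mul, ← ncard_eq_toFinset_card _ hTfin, mul_comm]
  omega

end S1

end PercRepro
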